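import Mathlib.Algebra.MvPolynomial.CommRing
import Mathlib.Data.Nat.Log
import Literature.Computability.AlgebraicComplexity.SOSDecomposition
import Literature.Computability.AlgebraicComplexity.DepthReductionProofs
import HarnessLib

/-!
# SOS decomposition of circuits (Dutta–Saxena–Thierauf, Lemma 3.1) — discharge

Discharge (D-0014) of the named fact
`Literature.Computability.AlgebraicComplexity.DuttaSaxenaThierauf2024_sosDecomposition`
(`SOSDecomposition.lean`): P. Dutta, N. Saxena, T. Thierauf, *Weighted sum-of-squares lower bounds
for univariate polynomials imply `VP ≠ VNP`*, comput. complexity **33** (2024), §3.1, Lemma 3.1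
(SOS decomposition; ITCS 2021 Main Lemma): a polynomial `p` of degree `d` with a circuit of size
`s` is `p = ∑_{i ≤ s'} cᵢ pᵢ²` with `s' = (sd)^{O(log d)}` and `deg pᵢ ≤ ⌈d/2⌉`; here with the
absolute constant `c = 8`: `s' ≤ (s·d + 2)^{8(⌊log₂ d⌋ + 1)}`, over every field with `2 ≠ 0`.

## The printed proof (§3.1, proof of Lemma 3.1) and its transcription

Print: (1) depth-reduce the circuit [VSBR83] to a homogeneous circuit of depth `log d`, size
`poly(s)`; (2) unfold it into a formula of size `s^{O(log d)}`; (3) turn the formula into an ABP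
of the same size [Sau12, Lemma 2.14]; (4) homogenize the ABP into a layered ABP with `d + 1`
layers (size `· (d+1)`), CUT it at layer `⌈d/2⌉`: `p = ∑ᵢ p_{i,1} p_{i,2}` over the nodes `vᵢ` of
that layer, `deg p_{i,1}, deg p_{i,2} ≤ ⌈d/2⌉`; finally eq. (4): `p₁p₂ = ¼(p₁+p₂)² − ¼(p₁−p₂)²`.
For inhomogeneous `p` the homogeneous parts have homogeneous circuits of size `O(sd²)`.

Transcription. The tree has no ABP carrier, but steps (1)–(2) are available on VALUES in
`GateQuotients.lean` (written for Tavenas' depth reduction and reused for `VP ⊆ VQP` in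
`VPDeterminantalQPProofs.lean`): the homogenization `SLP.homogenize d` of a straight-line program
(`≤ 4s(d+1)²` nodes, `SLP.card_node_le` — the printed `O(sd²)`), the Valiant–Skyum–Berkowitz–Rackoff
gate quotients, and ONE balanced expansion step `HomCircuit.expandAtom`: an atom (node value or
gate quotient) of formal degree `D ≥ 2` is a sum of `≤ #ι²` products of `≤ 5` atoms of formal
degree `≤ D/2` whose formal degrees add up to `D` (`expandAtom_sum/_tdeg/_half`,
`length_expandAtom_le`). Iterating it is exactly the formula of size `s^{O(log d)}` of step (2).
Steps (3)–(4) + the cut are performed *along* this recursion instead of on an ABP object: cutting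
the (layered ABP of the) product `a₁ ⋯ a_r` at layer `j` cuts precisely one factor `a_t` at the
induced layer `j − (deg a₁ + ⋯ + deg a_{t−1})` (`HomCircuit.bilin_term`), and cutting a sum cuts
every summand (`DepthReduction.bilin_concat`); hence (`HomCircuit.bilin_atom`) every atom of
formal degree `D` is, for EVERY cut `j`, a sum of at most `(#ι²)^{⌊log₂ D⌋}` products `g · h` with
`deg g ≤ j`, `deg h ≤ D − j` — the width of layer `j` of the homogeneous ABP of the printed proof.
Summing the homogeneous components (`SLP.bilin`, the factor `d + 1`) and extracting the
straight-line program from a fan-in-two circuit of size `complexity p`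
(`DepthReduction.exists_slp`, `ArithCircuit.exists_computes_size_eq_complexity`) gives
`exists_bilin_of_two_le_totalDegree`: `p = ∑ gᵢhᵢ` with `≤ (d+1)(4 L(p) (d+1)²)^{2⌊log₂ d⌋}`
terms, `deg gᵢ ≤ j`, `deg hᵢ ≤ d − j`. With `j = ⌈d/2⌉` and eq. (4)
(`isWeightedSOSRep_of_bilin`) this is Lemma 3.1 with `s' ≤ 2(d+1)(16 s²(d+1)⁴)^{⌊log₂ d⌋}
≤ (sd+2)^{8(⌊log₂ d⌋+1)}` for `d ≥ 2`; for `d ≤ 1` two squares suffice (eq. (3),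
`isWeightedSOSRep_two_squares`). The hypothesis `3 ≠ 0` of the fact is not used.

## References

* P. Dutta, N. Saxena, T. Thierauf, comput. complexity 33 (2024), §3.1, Lemma 3.1 and its proof,
  eq. (3)–(4) [DuttaSaxenaThierauf2024]; ITCS 2021, LIPIcs 185, 23, Main Lemma
  [DuttaSaxenaThierauf2021].
* L. G. Valiant, S. Skyum, S. Berkowitz, C. Rackoff, SIAM J. Comput. 12 (1983) 641–644
  [ValiantSkyumBerkowitzRackoff1983] (gate quotients, frontier identities).
* S. Tavenas, Inform. and Comput. 240 (2015), §4–§5 [Tavenas2015] (as formalised in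
  `GateQuotients.lean`).
-/

noncomputable section

open MvPolynomial

namespace Literature.Computability.AlgebraicComplexity

namespace DepthReduction

universe u v w

section Concat

variable {k : Type u} [CommSemiring k] {σ : Type v}

/-- Cutting a sum cuts every summand: bilinear decompositions `v T = ∑ g·h` (`deg g ≤ j`,
`deg h ≤ e`, at most `K` terms each) of the members of a list concatenate to one of their sum with
at most `|Ts| · K` terms (the nodes of one ABP layer of a sum of ABPs).
[cite: DuttaSaxenaThierauf2024, §3.1, proof of Lemma 3.1] -/
theorem bilin_concat {α : Type w} (v : α → MvPolynomial σ k) {j e K : ℕ} (Ts : List α)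
    (h : ∀ T ∈ Ts, ∃ L : List (MvPolynomial σ k × MvPolynomial σ k), L.length ≤ K ∧
      (∀ gh ∈ L, gh.1.totalDegree ≤ j ∧ gh.2.totalDegree ≤ e) ∧
      (L.map fun gh => gh.1 * gh.2).sum = v T) :
    ∃ L : List (MvPolynomial σ k × MvPolynomial σ k), L.length ≤ Ts.length * K ∧
      (∀ gh ∈ L, gh.1.totalDegree ≤ j ∧ gh.2.totalDegree ≤ e) ∧
      (L.map fun gh => gh.1 * gh.2).sum = (Ts.map v).sum := by
  induction Ts with
  | nil => exact ⟨[], by simp, by simp, by simp⟩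
  | cons T Ts ih =>
    obtain ⟨L₁, hL₁, hP₁, hS₁⟩ := h T (by simp)
    obtain ⟨L₂, hL₂, hP₂, hS₂⟩ := ih fun T' hT' => h T' (List.mem_cons_of_mem _ hT')
    refine ⟨L₁ ++ L₂, ?_, ?_, ?_⟩
    · rw [List.length_append, List.length_cons]
      calc L₁.length + L₂.length ≤ K + Ts.length * K := Nat.add_le_add hL₁ hL₂
        _ = (Ts.length + 1) * K := by ring
    · intro gh hgh
      rcases List.mem_append.1 hgh with h' | h'
      exacts [hP₁ gh h', hP₂ gh h']
    · rw [List.map_append, List.sum_append, hS₁, hS₂, List.map_cons, List.sum_cons]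

end Concat

namespace HomCircuit

variable {k : Type u} {σ : Type v} {ι : Type w} [CommSemiring k]
variable (H : HomCircuit k σ ι) [DecidableEq ι]

/-- The value of a term has total degree at most its formal degree.
[cite: Tavenas2015, §4, Lemma 2] -/
theorem totalDegree_tval_le (T : List (Atom ι)) : (H.tval T).totalDegree ≤ H.tdeg T := by
  induction T with
  | nil => simp
  | cons a T ih =>
    rw [tval_cons, tdeg_cons]
    exact (totalDegree_mul _ _).trans (Nat.add_le_add (H.totalDegree_aval_le a) ih)

/-- Cutting a product cuts one factor: if every atom of a term `T` has, at every cut, a bilinear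
decomposition with at most `K ≥ 1` terms, then so has the value of `T` — at cut `j` the factor
in which the cumulative formal degree crosses `j` is cut at the induced position and the other
factors are distributed to the two sides (the layer-`j` nodes of the ABP of a product).
[cite: DuttaSaxenaThierauf2024, §3.1, proof of Lemma 3.1] -/
theorem bilin_term {K : ℕ} (hK : 1 ≤ K) (T : List (Atom ι))
    (hT : ∀ b ∈ T, ∀ j : ℕ, ∃ L : List (MvPolynomial σ k × MvPolynomial σ k), L.length ≤ K ∧
      (∀ gh ∈ L, gh.1.totalDegree ≤ j ∧ gh.2.totalDegree ≤ H.adeg b - j) ∧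
      (L.map fun gh => gh.1 * gh.2).sum = H.aval b) (j : ℕ) :
    ∃ L : List (MvPolynomial σ k × MvPolynomial σ k), L.length ≤ K ∧
      (∀ gh ∈ L, gh.1.totalDegree ≤ j ∧ gh.2.totalDegree ≤ H.tdeg T - j) ∧
      (L.map fun gh => gh.1 * gh.2).sum = H.tval T := by
  induction T generalizing j with
  | nil => exact ⟨[(1, 1)], by simpa using hK, by simp, by simp⟩
  | cons b T ih =>
    have ih' := ih fun b' hb' => hT b' (List.mem_cons_of_mem _ hb')
    have hdT := H.totalDegree_tval_le T
    by_cases hj : j < H.adeg b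
    · -- the cut falls inside the first factor
      obtain ⟨L, hL, hP, hS⟩ := hT b (by simp) j
      refine ⟨L.map fun gh => (gh.1, gh.2 * H.tval T), by simpa using hL, ?_, ?_⟩
      · intro gh hgh
        obtain ⟨gh', hgh', rfl⟩ := List.mem_map.1 hgh
        obtain ⟨h1, h2⟩ := hP gh' hgh'
        dsimp only
        refine ⟨h1, (totalDegree_mul _ _).trans ?_⟩
        rw [tdeg_cons]
        omega
      · have hcomp : ((fun gh : MvPolynomial σ k × MvPolynomial σ k => gh.1 * gh.2) ∘
            fun gh : MvPolynomial σ k × MvPolynomial σ k => (gh.1, gh.2 * H.tval T)) =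
            fun gh => gh.1 * gh.2 * H.tval T := by
          funext gh
          simp [mul_assoc]
        rw [List.map_map, hcomp, List.sum_map_mul_right, hS, tval_cons]
    · -- the cut falls after the first factor
      obtain ⟨L, hL, hP, hS⟩ := ih' (j - H.adeg b)
      refine ⟨L.map fun gh => (H.aval b * gh.1, gh.2), by simpa using hL, ?_, ?_⟩
      · intro gh hgh
        obtain ⟨gh', hgh', rfl⟩ := List.mem_map.1 hgh
        obtain ⟨h1, h2⟩ := hP gh' hgh'
        have hb := H.totalDegree_aval_le b
        dsimp only
        refine ⟨(totalDegree_mul _ _).trans (by omega), ?_⟩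
        rw [tdeg_cons]
        omega
      · have hcomp : ((fun gh : MvPolynomial σ k × MvPolynomial σ k => gh.1 * gh.2) ∘
            fun gh : MvPolynomial σ k × MvPolynomial σ k => (H.aval b * gh.1, gh.2)) =
            fun gh => H.aval b * (gh.1 * gh.2) := by
          funext gh
          simp [mul_assoc]
        rw [List.map_map, hcomp, List.sum_map_mul_left, hS, tval_cons]

variable [Fintype ι]

/-- **The cut along the VSBR recursion** (width of one layer of the homogeneous ABP of the
`s^{O(log d)}`-size formula): every atom of formal degree `D` is, at every cut `j`, a sum of at
most `(#ι·#ι)^{⌊log₂ D⌋}` products `g · h` with `deg g ≤ j` and `deg h ≤ D − j` (strong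
induction on `D` through `expandAtom`).
[cite: DuttaSaxenaThierauf2024, §3.1, proof of Lemma 3.1, steps 1–4] -/
theorem bilin_atom_aux : ∀ (n : ℕ) (a : Atom ι), H.adeg a = n → ∀ j : ℕ,
    ∃ L : List (MvPolynomial σ k × MvPolynomial σ k),
      L.length ≤ (Fintype.card ι * Fintype.card ι) ^ Nat.log 2 (H.adeg a) ∧
      (∀ gh ∈ L, gh.1.totalDegree ≤ j ∧ gh.2.totalDegree ≤ H.adeg a - j) ∧
      (L.map fun gh => gh.1 * gh.2).sum = H.aval a := by
  intro n
  induction n using Nat.strong_induction_on with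
  | _ n ih =>
    intro a ha j
    have hne : Nonempty ι := by
      cases a with
      | node ν => exact ⟨ν⟩
      | quot ν μ => exact ⟨ν⟩
    set S := Fintype.card ι * Fintype.card ι with hSdef
    have hS : 0 < S := Nat.mul_pos Fintype.card_pos Fintype.card_pos
    have hdeg := H.totalDegree_aval_le a
    by_cases hj0 : j = 0
    · refine ⟨[(1, H.aval a)], by simpa using Nat.one_le_pow _ _ hS, ?_, by simp⟩
      intro gh hgh
      rw [List.mem_singleton] at hgh
      subst hgh
      simpa [hj0] using hdeg
    by_cases hjD : H.adeg a ≤ j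
    · refine ⟨[(H.aval a, 1)], by simpa using Nat.one_le_pow _ _ hS, ?_, by simp⟩
      intro gh hgh
      rw [List.mem_singleton] at hgh
      subst hgh
      simpa using hdeg.trans hjD
    -- `0 < j < adeg a`: expand the atom and cut every term
    have h2 : 2 ≤ H.adeg a := by omega
    set K := S ^ Nat.log 2 (H.adeg a / 2) with hKdef
    have hK : 1 ≤ K := Nat.one_le_pow _ _ hS
    have hterms : ∀ T ∈ H.expandAtom a, ∃ L : List (MvPolynomial σ k × MvPolynomial σ k),
        L.length ≤ K ∧ (∀ gh ∈ L, gh.1.totalDegree ≤ j ∧ gh.2.totalDegree ≤ H.adeg a - j) ∧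
        (L.map fun gh => gh.1 * gh.2).sum = H.tval T := by
      intro T hT
      have hTd := H.expandAtom_tdeg hT
      have hatoms : ∀ b ∈ T, ∀ j' : ℕ, ∃ L : List (MvPolynomial σ k × MvPolynomial σ k),
          L.length ≤ K ∧
          (∀ gh ∈ L, gh.1.totalDegree ≤ j' ∧ gh.2.totalDegree ≤ H.adeg b - j') ∧
          (L.map fun gh => gh.1 * gh.2).sum = H.aval b := by
        intro b hb j'
        have hb2 := H.expandAtom_half hT b hb
        obtain ⟨L, hL, hP, hSum⟩ := ih (H.adeg b) (by omega) b rfl j'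
        refine ⟨L, hL.trans ?_, hP, hSum⟩
        exact Nat.pow_le_pow_right hS (Nat.log_mono_right (by omega))
      obtain ⟨L, hL, hP, hSum⟩ := H.bilin_term hK T hatoms j
      rw [hTd] at hP
      exact ⟨L, hL, hP, hSum⟩
    obtain ⟨L, hL, hP, hSum⟩ := bilin_concat H.tval (H.expandAtom a) hterms
    refine ⟨L, hL.trans ?_, hP, hSum.trans (H.expandAtom_sum h2)⟩
    have hlog : Nat.log 2 (H.adeg a / 2) + 1 ≤ Nat.log 2 (H.adeg a) := by
      rw [Nat.log_div_base]
      have := Nat.log_pos one_lt_two h2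
      omega
    calc (H.expandAtom a).length * K ≤ S * K := Nat.mul_le_mul_right _ (H.length_expandAtom_le a)
      _ = S ^ (Nat.log 2 (H.adeg a / 2) + 1) := by rw [pow_succ, mul_comm]
      _ ≤ S ^ Nat.log 2 (H.adeg a) := Nat.pow_le_pow_right hS hlog

/-- Every atom of formal degree `D` is, at every cut `j`, a sum of at most `(#ι·#ι)^{⌊log₂ D⌋}`
products `g · h` with `deg g ≤ j`, `deg h ≤ D − j` (the cut of the homogeneous ABP of the
printed proof, realised along the VSBR recursion).
[cite: DuttaSaxenaThierauf2024, §3.1, proof of Lemma 3.1, steps 1–4] -/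
theorem bilin_atom (a : Atom ι) (j : ℕ) :
    ∃ L : List (MvPolynomial σ k × MvPolynomial σ k),
      L.length ≤ (Fintype.card ι * Fintype.card ι) ^ Nat.log 2 (H.adeg a) ∧
      (∀ gh ∈ L, gh.1.totalDegree ≤ j ∧ gh.2.totalDegree ≤ H.adeg a - j) ∧
      (L.map fun gh => gh.1 * gh.2).sum = H.aval a :=
  H.bilin_atom_aux _ a rfl j

end HomCircuit

namespace SLP

variable {k : Type u} [CommSemiring k] {σ : Type v}

/-- The cut for one homogeneous component of a value of a straight-line program of length `L`:
at most `(4L(d+1)²)^{2⌊log₂ e⌋}` products for the component of degree `e ≤ d`.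
[cite: DuttaSaxenaThierauf2024, §3.1, proof of Lemma 3.1] -/
theorem bilin_component (P : SLP k σ) (d : ℕ) (i : Fin P.len) (e : Fin (d + 1)) (j : ℕ) :
    ∃ L : List (MvPolynomial σ k × MvPolynomial σ k),
      L.length ≤ ((4 * P.len * (d + 1) ^ 2) * (4 * P.len * (d + 1) ^ 2)) ^ Nat.log 2 e.val ∧
      (∀ gh ∈ L, gh.1.totalDegree ≤ j ∧ gh.2.totalDegree ≤ e.val - j) ∧
      (L.map fun gh => gh.1 * gh.2).sum = homogeneousComponent e.val (P.val i.val) := by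
  classical
  obtain ⟨L, h1, h2, h3⟩ := (P.homogenize d).bilin_atom (.node (i, Tag.Q e)) j
  refine ⟨L, h1.trans ?_, h2, h3⟩
  exact Nat.pow_le_pow_left (Nat.mul_le_mul (P.card_node_le d) (P.card_node_le d)) _

/-- **The cut, inhomogeneous case** (sum over the homogeneous components, the factor `d + 1`):
a value of total degree `≤ d` of a straight-line program of length `L` is, at every cut `j`, a
sum of at most `(d+1)·(4L(d+1)²)^{2⌊log₂ d⌋}` products `g · h`, `deg g ≤ j`, `deg h ≤ d − j`.
[cite: DuttaSaxenaThierauf2024, §3.1, proof of Lemma 3.1] -/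
theorem bilin (P : SLP k σ) {d i : ℕ} (hi : i < P.len) (hd : (P.val i).totalDegree ≤ d)
    (j : ℕ) :
    ∃ L : List (MvPolynomial σ k × MvPolynomial σ k),
      L.length ≤ (d + 1) *
        ((4 * P.len * (d + 1) ^ 2) * (4 * P.len * (d + 1) ^ 2)) ^ Nat.log 2 d ∧
      (∀ gh ∈ L, gh.1.totalDegree ≤ j ∧ gh.2.totalDegree ≤ d - j) ∧
      (L.map fun gh => gh.1 * gh.2).sum = P.val i := by
  classical
  set S2 := (4 * P.len * (d + 1) ^ 2) * (4 * P.len * (d + 1) ^ 2) with hS2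
  have hS2pos : 0 < S2 := by
    have : 0 < P.len := by omega
    positivity
  have hcomp : ∀ e ∈ List.finRange (d + 1), ∃ L : List (MvPolynomial σ k × MvPolynomial σ k),
      L.length ≤ S2 ^ Nat.log 2 d ∧
      (∀ gh ∈ L, gh.1.totalDegree ≤ j ∧ gh.2.totalDegree ≤ d - j) ∧
      (L.map fun gh => gh.1 * gh.2).sum = homogeneousComponent e.val (P.val i) := by
    intro e _
    have he := e.isLt
    obtain ⟨L, hL, hP, hS⟩ := P.bilin_component d ⟨i, hi⟩ e j
    refine ⟨L, hL.trans (Nat.pow_le_pow_right hS2pos (Nat.log_mono_right (by omega))),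
      fun gh hgh => ⟨(hP gh hgh).1, (hP gh hgh).2.trans (by omega)⟩, hS⟩
  obtain ⟨L, hL, hP, hS⟩ :=
    bilin_concat (fun e : Fin (d + 1) => homogeneousComponent e.val (P.val i))
      (List.finRange (d + 1)) hcomp
  refine ⟨L, by simpa [List.length_finRange] using hL, hP, ?_⟩
  rw [hS]
  calc ((List.finRange (d + 1)).map fun e : Fin (d + 1) =>
          homogeneousComponent e.val (P.val i)).sum
        = ∑ e : Fin (d + 1), homogeneousComponent e.val (P.val i) := (Fin.sum_univ_def _).symm
    _ = ∑ e ∈ Finset.range (d + 1), homogeneousComponent e (P.val i) :=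
        Fin.sum_univ_eq_sum_range (fun e => homogeneousComponent e (P.val i)) (d + 1)
    _ = P.val i := sum_homogeneousComponent_of_le hd

end SLP

end DepthReduction

/-! ### From circuits to products of two, and to squares -/

section Assembly

universe u v

open DepthReduction

/-- **Sum of products of two along the middle cut** (the content of steps 1–4 of the printed
proof): a polynomial `p` of total degree `d ≥ 2` is, at every cut `j`, a sum of at most
`(d+1)·(4·L(p)·(d+1)²)^{2⌊log₂ d⌋}` products `g · h` with `deg g ≤ j`, `deg h ≤ d − j`, where
`L(p) = complexity p ≥ 1`. [cite: DuttaSaxenaThierauf2024, §3.1, proof of Lemma 3.1] -/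
theorem exists_bilin_of_two_le_totalDegree {k : Type u} [CommSemiring k] {σ : Type v}
    (p : MvPolynomial σ k) (hd : 2 ≤ p.totalDegree) (j : ℕ) :
    1 ≤ complexity p ∧ ∃ L : List (MvPolynomial σ k × MvPolynomial σ k),
      L.length ≤ (p.totalDegree + 1) *
        ((4 * complexity p * (p.totalDegree + 1) ^ 2) *
          (4 * complexity p * (p.totalDegree + 1) ^ 2)) ^ Nat.log 2 p.totalDegree ∧
      (∀ gh ∈ L, gh.1.totalDegree ≤ j ∧ gh.2.totalDegree ≤ p.totalDegree - j) ∧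
      (L.map fun gh => gh.1 * gh.2).sum = p := by
  obtain ⟨P, hfan, hcomp, hsize⟩ := ArithCircuit.exists_computes_size_eq_complexity p
  obtain ⟨S, hlen, hcases⟩ := exists_slp P hfan
  rw [show P.eval = p from hcomp] at hcases
  rcases hcases with ⟨i, hi, hpi⟩ | ⟨x, hpx⟩ | ⟨c, hpc⟩
  · have hdi : (S.val i).totalDegree ≤ p.totalDegree := by rw [← hpi]
    obtain ⟨L, hL, hP, hS⟩ := S.bilin hi hdi j
    rw [hlen, hsize] at hL hi
    exact ⟨by omega, L, hL, hP, hS.trans hpi.symm⟩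
  · exfalso
    rw [hpx] at hd
    exact absurd (hd.trans (totalDegree_X_le x)) (by norm_num)
  · exfalso
    rw [hpc, totalDegree_C] at hd
    exact absurd hd (by norm_num)

variable {F : Type u} [Field F] {σ : Type v}

/-- **Eq. (4) termwise:** `∑ᵢ gᵢhᵢ = ∑ᵢ ¼(gᵢ+hᵢ)² − ∑ᵢ ¼(gᵢ−hᵢ)²` over a field with `2 ≠ 0`,
as a weighted-SOS representation with `2·|L|` squares.
[cite: DuttaSaxenaThierauf2024, §3.1, proof of Lemma 3.1, eq. (4)] -/
theorem isWeightedSOSRep_of_bilin (h2 : (2 : F) ≠ 0)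
    (L : List (MvPolynomial σ F × MvPolynomial σ F)) :
    IsWeightedSOSRep ((L.map fun gh => gh.1 * gh.2).sum)
      (Fin.append (fun _ : Fin L.length => (4 : F)⁻¹) (fun _ : Fin L.length => -(4 : F)⁻¹))
      (Fin.append (fun i : Fin L.length => (L[i.1]).1 + (L[i.1]).2)
        (fun i : Fin L.length => (L[i.1]).1 - (L[i.1]).2)) := by
  have h4 : (4 : F) ≠ 0 := by
    have : (4 : F) = 2 * 2 := by norm_num
    rw [this]
    exact mul_ne_zero h2 h2
  have hC : C (4 : F)⁻¹ * (4 : MvPolynomial σ F) = 1 := by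
    rw [← map_ofNat C 4, ← C_mul, inv_mul_cancel₀ h4, C_1]
  have key : ∀ g h : MvPolynomial σ F,
      C (4 : F)⁻¹ * (g + h) ^ 2 + C (-(4 : F)⁻¹) * (g - h) ^ 2 = g * h := by
    intro g h
    have : C (4 : F)⁻¹ * (g + h) ^ 2 + C (-(4 : F)⁻¹) * (g - h) ^ 2 =
        C (4 : F)⁻¹ * (4 : MvPolynomial σ F) * (g * h) := by
      rw [map_neg]
      ring
    rw [this, hC, one_mul]
  unfold IsWeightedSOSRep
  rw [Fin.sum_univ_add]
  simp only [Fin.append_left, Fin.append_right]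
  rw [← Finset.sum_add_distrib]
  simp_rw [key]
  exact (Fin.sum_univ_fun_getElem L fun gh => gh.1 * gh.2).symm

/-- **Discharge of `DuttaSaxenaThierauf2024_sosDecomposition`** (Dutta–Saxena–Thierauf 2024,
Lemma 3.1; ITCS 2021 Main Lemma) with the absolute constant `c = 8`: over a field with `2 ≠ 0`
(the hypothesis `3 ≠ 0` is not needed), a polynomial `p` of degree `d` with `complexity p ≤ s`
is `∑_{i < s'} aᵢ qᵢ²` with `s' ≤ (sd + 2)^{8(⌊log₂ d⌋ + 1)}` and `deg qᵢ ≤ ⌈d/2⌉`.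
[cite: DuttaSaxenaThierauf2024, §3.1, Lemma 3.1] -/
theorem DuttaSaxenaThierauf2024_sosDecomposition_holds :
    DuttaSaxenaThierauf2024_sosDecomposition := by
  refine ⟨8, fun F _ h2 _ n s p hp => ?_⟩
  rcases Nat.lt_or_ge p.totalDegree 2 with hd | hd
  · -- degree `≤ 1`: two squares, eq. (3)
    refine ⟨2, _, _, ?_, ?_, isWeightedSOSRep_two_squares h2 p⟩
    · have hB : 0 < s * p.totalDegree + 2 := by omega
      calc 2 ≤ s * p.totalDegree + 2 := by omega
        _ = (s * p.totalDegree + 2) ^ 1 := (pow_one _).symm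
        _ ≤ (s * p.totalDegree + 2) ^ (8 * (Nat.log 2 p.totalDegree + 1)) :=
          Nat.pow_le_pow_right hB (by omega)
    · have hC1 : ∀ c : F, (p + C c).totalDegree ≤ (p.totalDegree + 1) / 2 := fun c =>
        (totalDegree_add _ _).trans (max_le (by omega) (by rw [totalDegree_C]; omega))
      intro i
      fin_cases i
      · exact hC1 1
      · exact hC1 (-1)
  · -- degree `≥ 2`: the middle cut and eq. (4)
    obtain ⟨hs1, L, hL, hP, hS⟩ := exists_bilin_of_two_le_totalDegree p hd ((p.totalDegree + 1) / 2)
    have hrep := isWeightedSOSRep_of_bilin h2 L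
    rw [hS] at hrep
    refine ⟨L.length + L.length, _, _, ?_, ?_, hrep⟩
    · -- the count: `2 (d+1) (16 L(p)² (d+1)⁴)^{⌊log₂ d⌋} ≤ (sd+2)^{8(⌊log₂ d⌋+1)}`
      set d := p.totalDegree with hddef
      set m := Nat.log 2 d with hmdef
      set B := s * d + 2 with hBdef
      have hs : 1 ≤ s := hs1.trans hp
      have hB4 : 4 ≤ B := by rw [hBdef]; nlinarith
      have hdB : d + 1 ≤ B := by rw [hBdef]; nlinarith
      have hcB : complexity p ≤ B := by rw [hBdef]; nlinarith
      have hX : 4 * complexity p * (d + 1) ^ 2 ≤ B ^ 4 := by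
        calc 4 * complexity p * (d + 1) ^ 2 ≤ B * B * B ^ 2 :=
              Nat.mul_le_mul (Nat.mul_le_mul hB4 hcB) (Nat.pow_le_pow_left hdB 2)
          _ = B ^ 4 := by ring
      have hX2 : (4 * complexity p * (d + 1) ^ 2) * (4 * complexity p * (d + 1) ^ 2) ≤ B ^ 8 := by
        calc _ ≤ B ^ 4 * B ^ 4 := Nat.mul_le_mul hX hX
          _ = B ^ 8 := by ring
      have hpow := Nat.pow_le_pow_left hX2 m
      calc L.length + L.length
          ≤ 2 * ((d + 1) * ((4 * complexity p * (d + 1) ^ 2) *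
              (4 * complexity p * (d + 1) ^ 2)) ^ m) := by omega
        _ ≤ B * (B * (B ^ 8) ^ m) := Nat.mul_le_mul (by omega) (Nat.mul_le_mul hdB hpow)
        _ = B ^ (8 * m + 1 + 1) := by rw [← pow_mul, ← pow_succ', ← pow_succ']
        _ ≤ B ^ (8 * (m + 1)) := Nat.pow_le_pow_right (by omega) (by omega)
    · -- the degrees: `deg (g ± h) ≤ ⌈d/2⌉`
      intro i
      induction i using Fin.addCases with
      | left i =>
        rw [Fin.append_left]
        obtain ⟨h1, h2⟩ := hP _ (List.getElem_mem i.2)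
        exact (totalDegree_add _ _).trans (max_le h1 (h2.trans (by omega)))
      | right i =>
        rw [Fin.append_right]
        obtain ⟨h1, h2⟩ := hP _ (List.getElem_mem i.2)
        exact (totalDegree_sub _ _).trans (max_le h1 (h2.trans (by omega)))

end Assembly

end Literature.Computability.AlgebraicComplexity

end
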